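import Mathlib
import HarnessLib
import Summits.QuantumFields.YangMills.Theorems.DirichletWindowXiDivergesOfLocalGaussianity
import Summits.QuantumFields.YangMills.Theorems.DirichletWindowAxialCorrLength
import Literature.MathematicalPhysics.QuantumFieldTheory.YangMillsOS
import Literature.MathematicalPhysics.QuantumLattice.GaugeGroupsProofs
import Literature.MathematicalPhysics.QuantumLattice.RepLieAlgebraUnitary
import Literature.MathematicalPhysics.QuantumLattice.LatticeGaugeDLRLimitPointsProofs

/-!
# `XiDiverges` for `SU(N)`, `N ≥ 2`: hypothesis-free specialisations (referee record)

Ideator seat ym-idea-4 g5 (technique card «spectral / trace methods»), referee-bundle companion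
(`pub/ym-ir/REFEREE-BUNDLE-XiDiverges.md` §(iii)). The closed item stmt-QuantumFields-8941
`DirichletWindow.XiDiverges` (`Theorems.xiDiverges_proof`, p603940) and the record
`AxialCorrLength.axialCorrLengthDiverges` (p605756) quantify over an ABSTRACT compact group `G`
under the hypothesis `IsCompactSimpleLieGroup G` and over an abstract faithful unitary lattice
representation `r`. This module discharges every binder BY NAME for the groups of the Clay text:

* the hypothesis is inhabited: `SU(N)`, `N ≥ 2`, satisfies `IsCompactSimpleLieGroup` by the tree
  theorem `isCompactSimpleLieGroup_specialUnitaryGroup` applied to the PROVED fact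
  `isSimpleCompactGroup_specialUnitaryGroup_holds` (used inline below; the same term is landed by
  name as `FemtoCurvatureTwoPoint.Negative.UnfaithfulFalseSU.isCompactSimpleLieGroup_su`; no named
  fact is assumed);
* `infiniteVolumeLimitPoints_SU_nonempty` — for the fundamental representation and every `β`
  the set of 4-d torus-limit states is non-empty (`infiniteVolumeLimitPoints_nonempty_holds`), so
  the `∀ μ` below is never vacuous;
* `xiDiverges_SU`, `xiDiverges_SU_nonvacuous`, `xiDiverges_SU2`, `xiDiverges_SU3` — the axial
  lower envelope `A e^{-m n} ≤ f_β(n e₀)` with `0 ≤ m ≤ ε` for every torus-limit state of the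
  `SU(N)` Wilson theory in the fundamental representation, `β ≥ β₁(N, ε)`;
* `axialCorrLengthDiverges_SU`, `axialCorrLength_ge_SU` — the axial correlation length exists
  (`HasInvCorrLength`) and is `≥ ξ₀` (or infinite, `m = 0`) beyond `β₁(N, ξ₀)`.

All proofs are instantiations (closed terms; axioms = the three standard ones). HONEST SCOPE: lattice,
axial direction, lower bound only; `m = 0` is not excluded; nothing about a mass gap, a continuum
limit, or the summit `YangMills` is proved here.
-/

namespace Summit.QuantumFields.YangMills.Theorems.XiDivergesSU

open MeasureTheory Filter
open Literature.MathematicalPhysics.QuantumFieldTheory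
open Literature.MathematicalPhysics.QuantumLattice
open Literature.Probability.LatticeModels

/-- Non-vacuity of the state quantifier: for the fundamental representation of `SU(N)` and every
coupling `β`, the set of infinite-volume torus-limit states on `ℤ⁴` is non-empty. -/
theorem infiniteVolumeLimitPoints_SU_nonempty (N : ℕ) (β : ℝ) :
    (infiniteVolumeLimitPoints (d := 4) (fundamentalLatticeRep N).ρ β).Nonempty :=
  infiniteVolumeLimitPoints_nonempty_holds (ρ := (fundamentalLatticeRep N).ρ)
    (fundamentalLatticeRep N).continuous β

/-- **`XiDiverges` for `SU(N)`, `N ≥ 2`, fundamental representation** (item 8941 instantiated):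
for every `ε > 0` there is `β₁` such that for all `β ≥ β₁` and every torus-limit state `μ` at `β`,
`A e^{-m n} ≤ f_β(n e₀)` for all `n`, with `A > 0` and `0 ≤ m ≤ ε`. -/
theorem xiDiverges_SU {N : ℕ} (hN : 2 ≤ N) (ε : ℝ) (hε : 0 < ε) :
    ∃ β₁ : ℝ, ∀ β : ℝ, β₁ ≤ β →
      ∀ μ ∈ infiniteVolumeLimitPoints (d := 4) (fundamentalLatticeRep N).ρ β,
        ∃ m A : ℝ, 0 < A ∧ 0 ≤ m ∧ m ≤ ε ∧
          ∀ n : ℕ, A * Real.exp (-(m * n)) ≤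
            plaquetteCorrFn (fundamentalLatticeRep N).ρ μ
              ((n : ℤ) • Pi.single (0 : Fin 4) (1 : ℤ)) :=
  xiDiverges_proof (Matrix.specialUnitaryGroup (Fin N) ℂ) (isCompactSimpleLieGroup_specialUnitaryGroup isSimpleCompactGroup_specialUnitaryGroup_holds hN)
    (fundamentalLatticeRep N) ε hε

/-- `XiDiverges` for `SU(N)` with the state quantifier certified non-vacuous at every `β ≥ β₁`. -/
theorem xiDiverges_SU_nonvacuous {N : ℕ} (hN : 2 ≤ N) (ε : ℝ) (hε : 0 < ε) :
    ∃ β₁ : ℝ, ∀ β : ℝ, β₁ ≤ β →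
      (infiniteVolumeLimitPoints (d := 4) (fundamentalLatticeRep N).ρ β).Nonempty ∧
      ∀ μ ∈ infiniteVolumeLimitPoints (d := 4) (fundamentalLatticeRep N).ρ β,
        ∃ m A : ℝ, 0 < A ∧ 0 ≤ m ∧ m ≤ ε ∧
          ∀ n : ℕ, A * Real.exp (-(m * n)) ≤
            plaquetteCorrFn (fundamentalLatticeRep N).ρ μ
              ((n : ℤ) • Pi.single (0 : Fin 4) (1 : ℤ)) := by
  obtain ⟨β₁, h⟩ := xiDiverges_SU hN ε hε
  exact ⟨β₁, fun β hβ => ⟨infiniteVolumeLimitPoints_SU_nonempty N β, h β hβ⟩⟩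

/-- `XiDiverges` for `SU(2)` (fundamental representation). -/
theorem xiDiverges_SU2 (ε : ℝ) (hε : 0 < ε) :
    ∃ β₁ : ℝ, ∀ β : ℝ, β₁ ≤ β →
      ∀ μ ∈ infiniteVolumeLimitPoints (d := 4) (fundamentalLatticeRep 2).ρ β,
        ∃ m A : ℝ, 0 < A ∧ 0 ≤ m ∧ m ≤ ε ∧
          ∀ n : ℕ, A * Real.exp (-(m * n)) ≤
            plaquetteCorrFn (fundamentalLatticeRep 2).ρ μ
              ((n : ℤ) • Pi.single (0 : Fin 4) (1 : ℤ)) :=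
  xiDiverges_SU le_rfl ε hε

/-- `XiDiverges` for `SU(3)` (fundamental representation; the gauge group of the `QCD` conjunct). -/
theorem xiDiverges_SU3 (ε : ℝ) (hε : 0 < ε) :
    ∃ β₁ : ℝ, ∀ β : ℝ, β₁ ≤ β →
      ∀ μ ∈ infiniteVolumeLimitPoints (d := 4) (fundamentalLatticeRep 3).ρ β,
        ∃ m A : ℝ, 0 < A ∧ 0 ≤ m ∧ m ≤ ε ∧
          ∀ n : ℕ, A * Real.exp (-(m * n)) ≤
            plaquetteCorrFn (fundamentalLatticeRep 3).ρ μ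
              ((n : ℤ) • Pi.single (0 : Fin 4) (1 : ℤ)) :=
  xiDiverges_SU (by norm_num) ε hε

/-- **Axial correlation length of `SU(N)` exists and diverges** (record p605756 instantiated): for
every `ε > 0`, beyond `β₁(N, ε)` every torus-limit state has a strictly positive axial plaquette
two-point function with an inverse correlation length `m ∈ [0, ε]` (`HasInvCorrLength`) and the
matching one-step upper envelope. -/
theorem axialCorrLengthDiverges_SU {N : ℕ} (hN : 2 ≤ N) (ε : ℝ) (hε : 0 < ε) :
    ∃ β₁ : ℝ, ∀ β : ℝ, β₁ ≤ β →
      ∀ μ ∈ infiniteVolumeLimitPoints (d := 4) (fundamentalLatticeRep N).ρ β,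
        (∀ n : ℕ, 0 < plaquetteCorrFn (fundamentalLatticeRep N).ρ μ
            ((n : ℤ) • Pi.single (0 : Fin 4) (1 : ℤ))) ∧
        ∃ m : ℝ, 0 ≤ m ∧ m ≤ ε ∧
          HasInvCorrLength (plaquetteCorrFn (fundamentalLatticeRep N).ρ μ) m ∧
          ∀ n : ℕ, 1 ≤ n →
            plaquetteCorrFn (fundamentalLatticeRep N).ρ μ ((n : ℤ) • Pi.single (0 : Fin 4) (1 : ℤ)) ≤
              plaquetteCorrFn (fundamentalLatticeRep N).ρ μ (Pi.single (0 : Fin 4) (1 : ℤ)) *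
                Real.exp (-(m * ((n : ℝ) - 1))) :=
  AxialCorrLength.axialCorrLengthDiverges (Matrix.specialUnitaryGroup (Fin N) ℂ)
    (isCompactSimpleLieGroup_specialUnitaryGroup isSimpleCompactGroup_specialUnitaryGroup_holds hN) (fundamentalLatticeRep N) ε hε

/-- **`ξ ≥ ξ₀` eventually, for `SU(N)`**: for every target length `ξ₀ > 0` there is `β₁` such that
for all `β ≥ β₁` and every torus-limit state, the axial inverse correlation length `m` exists and
either vanishes (`ξ = ∞`) or satisfies `ξ₀ ≤ 1/m`. -/
theorem axialCorrLength_ge_SU {N : ℕ} (hN : 2 ≤ N) (ξ₀ : ℝ) (hξ₀ : 0 < ξ₀) :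
    ∃ β₁ : ℝ, ∀ β : ℝ, β₁ ≤ β →
      ∀ μ ∈ infiniteVolumeLimitPoints (d := 4) (fundamentalLatticeRep N).ρ β,
        ∃ m : ℝ, 0 ≤ m ∧ HasInvCorrLength (plaquetteCorrFn (fundamentalLatticeRep N).ρ μ) m ∧
          (m = 0 ∨ ξ₀ ≤ 1 / m) := by
  obtain ⟨β₁, h⟩ := axialCorrLengthDiverges_SU hN (1 / ξ₀) (one_div_pos.mpr hξ₀)
  refine ⟨β₁, fun β hβ μ hμ => ?_⟩
  obtain ⟨-, m, hm0, hmε, hinv, -⟩ := h β hβ μ hμ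
  refine ⟨m, hm0, hinv, ?_⟩
  rcases hm0.eq_or_lt with hm | hm
  · exact Or.inl hm.symm
  · right
    have := one_div_le_one_div_of_le hm hmε
    rwa [one_div_one_div] at this

end Summit.QuantumFields.YangMills.Theorems.XiDivergesSU
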